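import Summits.CriticalPhenomena.PercolationContinuityZ3.Theorems.Transplant.FKDoubleFanLetterCone
import Summits.CriticalPhenomena.PercolationContinuityZ3.Theorems.Transplant.FKDoubleFanOneSidedCorePos
import Summits.CriticalPhenomena.PercolationContinuityZ3.Theorems.Transplant.FKDoubleFanMultifan
import HarnessLib

/-!
# Double fans `K₂ ∨ P_{m+1}`: ONE-SIDED DOMINANCE — the far cross-apex pair at every distance and for EVERY middle word,
# reduced to two closure statements about one-sided images

Helper file (`--supports stmt-CriticalPhenomena-4575`), FK sub-lane `prim-bschramm-fk-3` (gen 36); builds on p205010 (kernel theorem, internal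
audit signed; external expert review pending).  No named facts, no sorries; standard axioms.  Memo `bschramm/prim-bschramm-fk-3/FAR-CROSS-XI.md`.

THE CANDIDATE CONE.  Let `osCone q` be the closed convex cone DUAL to the one-sided images: `β ∈ osCone q` iff `pairH q β γ ≥ 0` for every bivector
`γ` that pairs non-negatively with all **`imgA q F w`** `= (fanCombo F (AC_0 w)) ∧ (fanCombo F (AC_1 w))` and all **`imgB q G w`**
`= (fanComboB G (AC_0 w)) ∧ (fanComboB G (AC_1 w))`, `F, G, w ∈ InKE q` (**`OSDual`**).  It contains every one-sided image, in particular every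
input pair bivector `u ∧ P_a u` (`F = fanInit`; **`input_mem_osCone`**), and — this is LEMMA′ of `…OneSidedCorePos` (`fanPhi_nonneg`) together with
the mirror identity **`rayleigh_imgB`** (`Z¹⁰Z⁰¹ − Z¹¹Z⁰⁰` through a `b`-fan `= q²·Φ_q(swapAC G; swapAB s, swapAB u)`) — every target bivector
`(s ∗ BC_0) ∧ (s ∗ BC_1)`, `s ∈ InKE q`, lies in `OSDual q` (**`target_osDual`**), so `osCone q` pairs non-negatively with all targets.  By the
self-adjointness of the letters (`…DoubleFanLetterCone`) and the fan algebras (`rimStep_fanCombo(B)`, `conv_edgeAC_fanCombo`, `conv_edgeBC_fanComboB`)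
the cone `osCone q` is an `IsLetterCone` as soon as
  **(CL-a)** `HypA q`: `∧²AC_x · imgB q G w ∈ osCone q` (an `a`-spoke after a `b`-fan), and
  **(CL-b)** `HypB q`: `∧²BC_y · imgA q F w ∈ osCone q` (a `b`-spoke after an `a`-fan), for all `F, G, w ∈ InKE q`, `x, y ∈ [0,1]`
(**`isLetterCone_osCone`**).  Consequently (**`rayleigh_crossFar_of_dominance`**, **`negCorr_spokes_cross_far_of_dominance`**): under (CL-a) and
(CL-b), for `0 < q ≤ 1`, EVERY cross-apex pair `(a c_j, b c_k)`, `j < k ≤ m`, of EVERY weighted double fan is negatively correlated — all middles,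
all distances.  Numerically (memo §3: non-negative least squares against sampled one-sided images, residuals `≤ 1e−6` for all tested true words of
length `≤ 6` at `q ∈ {0.02,…,0.95}`) both closure statements — indeed the membership of every true word image in the cone — hold; they are the
remaining finite-parametric targets of the programme (the cone is generated by the endpoint-shape images, memo §3).
[cite: Grimmett2006, §3.9 eq. (3.94) (pp. 63–64)] [folklore]
-/

noncomputable section

namespace Summit.CriticalPhenomena.PercolationContinuityZ3.Theorems

namespace FK

namespace ThreeApex

/-! ### One-sided images and the dual cone -/

/-- The image of the `a`-pinned input pair `(AC_0 w, AC_1 w)` under the `a`-fan with fan vector `F`. [folklore] -/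
def imgA (q : ℝ) (F w : V5) : Biv := wedgeH (fanCombo q F (conv (edgeAC 0) w)) (fanCombo q F (conv (edgeAC 1) w))

/-- The image of the `a`-pinned input pair under the `b`-fan with fan vector `G`. [folklore] -/
def imgB (q : ℝ) (G w : V5) : Biv := wedgeH (fanComboB q G (conv (edgeAC 0) w)) (fanComboB q G (conv (edgeAC 1) w))

/-- The DUAL of the one-sided images: bivectors pairing non-negatively with every `imgA q F w` and every `imgB q G w`, `F, G, w ∈ InKE q`. [folklore] -/
def OSDual (q : ℝ) (γ : Biv) : Prop :=
  (∀ F w : V5, InKE q F → InKE q w → 0 ≤ pairH q (imgA q F w) γ) ∧ (∀ G w : V5, InKE q G → InKE q w → 0 ≤ pairH q (imgB q G w) γ)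

/-- **The one-sided cone**: the closed convex cone bi-dual to the one-sided images. [folklore] -/
def osCone (q : ℝ) : Set Biv := {β | ∀ γ : Biv, OSDual q γ → 0 ≤ pairH q β γ}

/-- `a`-fan images lie in the one-sided cone. [folklore] -/
theorem imgA_mem_osCone {q : ℝ} {F w : V5} (hF : InKE q F) (hw : InKE q w) : imgA q F w ∈ osCone q :=
  fun _ hγ => hγ.1 F w hF hw

/-- `b`-fan images lie in the one-sided cone. [folklore] -/
theorem imgB_mem_osCone {q : ℝ} {G w : V5} (hG : InKE q G) (hw : InKE q w) : imgB q G w ∈ osCone q :=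
  fun _ hγ => hγ.2 G w hG hw

/-- The input pair bivector is the `a`-image through the trivial fan. [folklore] -/
theorem imgA_fanInit (q : ℝ) (u : V5) : imgA q fanInit u = wedgeH (conv (edgeAC 0) u) (conv (edgeAC 1) u) := by
  rw [imgA, fanCombo_init, fanCombo_init]

/-- **Inputs lie in the one-sided cone.** [folklore] -/
theorem input_mem_osCone {q : ℝ} {u : V5} (hu : InKE q u) : wedgeH (conv (edgeAC 0) u) (conv (edgeAC 1) u) ∈ osCone q := by
  rw [← imgA_fanInit]; exact imgA_mem_osCone (fanInit_inKE q) hu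

/-- A rim step on an `a`-image is the `a`-image of the rim-stepped fan vector. [folklore] -/
theorem opE_imgA (q r : ℝ) (F w : V5) : opE q r (imgA q F w) = imgA q (rimStep q r F) w := by
  simp only [imgA, opE_wedgeH, rimStep_fanCombo]

/-- An `a`-spoke on an `a`-image is the `a`-image of the extended fan vector. [folklore] -/
theorem opAC_imgA (q x : ℝ) (F w : V5) : opAC x (imgA q F w) = imgA q (conv (edgeBC x) F) w := by
  simp only [imgA, opAC_wedgeH, conv_edgeAC_fanCombo]

/-- A rim step on a `b`-image is the `b`-image of the rim-stepped fan vector. [folklore] -/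
theorem opE_imgB (q r : ℝ) (G w : V5) : opE q r (imgB q G w) = imgB q (rimStep q r G) w := by
  simp only [imgB, opE_wedgeH, rimStep_fanComboB]

/-- A `b`-spoke on a `b`-image is the `b`-image of the extended fan vector. [folklore] -/
theorem opBC_imgB (q y : ℝ) (G w : V5) : opBC y (imgB q G w) = imgB q (conv (edgeBC y) G) w := by
  simp only [imgB, opBC_wedgeH, conv_edgeBC_fanComboB]

/-- An `a`-spoke on a `b`-image, written out: the pair `(AC_x (fanComboB G (AC_0 w)), AC_x (fanComboB G (AC_1 w)))`. [folklore] -/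
theorem opAC_imgB (q x : ℝ) (G w : V5) :
    opAC x (imgB q G w) = wedgeH (conv (edgeAC x) (fanComboB q G (conv (edgeAC 0) w))) (conv (edgeAC x) (fanComboB q G (conv (edgeAC 1) w))) := by
  rw [imgB, opAC_wedgeH]

/-- A `b`-spoke on an `a`-image, written out. [folklore] -/
theorem opBC_imgA (q y : ℝ) (F w : V5) :
    opBC y (imgA q F w) = wedgeH (conv (edgeBC y) (fanCombo q F (conv (edgeAC 0) w))) (conv (edgeBC y) (fanCombo q F (conv (edgeAC 1) w))) := by
  rw [imgA, opBC_wedgeH]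

/-- **(CL-a)**: every `a`-spoke applied to every `b`-fan image of an input stays in the one-sided cone. [folklore] -/
def HypA (q : ℝ) : Prop := ∀ (G w : V5) (x : ℝ), InKE q G → InKE q w → 0 ≤ x → x ≤ 1 → opAC x (imgB q G w) ∈ osCone q

/-- **(CL-b)**: every `b`-spoke applied to every `a`-fan image of an input stays in the one-sided cone. [folklore] -/
def HypB (q : ℝ) : Prop := ∀ (F w : V5) (y : ℝ), InKE q F → InKE q w → 0 ≤ y → y ≤ 1 → opBC y (imgA q F w) ∈ osCone q

namespace OSDual

variable {q : ℝ} {γ : Biv}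

/-- The dual is stable under rim steps. [folklore] -/
theorem rim (hγ : OSDual q γ) {r : ℝ} (hr0 : 0 ≤ r) (hr1 : r ≤ 1) : OSDual q (opE q r γ) := by
  refine ⟨fun F w hF hw => ?_, fun G w hG hw => ?_⟩
  · rw [← pairH_opE, opE_imgA]; exact hγ.1 _ _ (InKE.rim hr0 hr1 hF) hw
  · rw [← pairH_opE, opE_imgB]; exact hγ.2 _ _ (InKE.rim hr0 hr1 hG) hw

/-- The dual is stable under `a`-spokes, given (CL-a). [folklore] -/
theorem ac (hγ : OSDual q γ) (hA : HypA q) {x : ℝ} (hx0 : 0 ≤ x) (hx1 : x ≤ 1) : OSDual q (opAC x γ) := by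
  refine ⟨fun F w hF hw => ?_, fun G w hG hw => ?_⟩
  · rw [← pairH_opAC, opAC_imgA]; exact hγ.1 _ _ (InKE.step (IsLetter.bc hx0 hx1) hF) hw
  · rw [← pairH_opAC]; exact hA G w x hG hw hx0 hx1 γ hγ

/-- The dual is stable under `b`-spokes, given (CL-b). [folklore] -/
theorem bc (hγ : OSDual q γ) (hB : HypB q) {y : ℝ} (hy0 : 0 ≤ y) (hy1 : y ≤ 1) : OSDual q (opBC y γ) := by
  refine ⟨fun F w hF hw => ?_, fun G w hG hw => ?_⟩
  · rw [← pairH_opBC]; exact hB F w y hF hw hy0 hy1 γ hγ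
  · rw [← pairH_opBC, opBC_imgB]; exact hγ.2 _ _ (InKE.step (IsLetter.bc hy0 hy1) hG) hw

end OSDual

/-- **Under (CL-a) and (CL-b) the one-sided cone is a letter cone.** [folklore] -/
theorem isLetterCone_osCone {q : ℝ} (hA : HypA q) (hB : HypB q) : IsLetterCone q (osCone q) where
  zero_mem := fun γ _ => le_of_eq (pairH_zero_left q γ).symm
  add_mem := fun β γ hβ hγ δ hδ => by rw [pairH_add_left]; exact add_nonneg (hβ δ hδ) (hγ δ hδ)
  smul_mem := fun a β ha hβ δ hδ => by rw [pairH_smul_left]; exact mul_nonneg ha (hβ δ hδ)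
  rim := fun r β hr0 hr1 hβ γ hγ => by rw [pairH_opE]; exact hβ _ (hγ.rim hr0 hr1)
  ac := fun x β hx0 hx1 hβ γ hγ => by rw [pairH_opAC]; exact hβ _ (hγ.ac hA hx0 hx1)
  bc := fun y β hy0 hy1 hβ γ hγ => by rw [pairH_opBC]; exact hβ _ (hγ.bc hB hy0 hy1)

/-! ### Targets lie in the dual: LEMMA′ and its mirror -/

/-- The pinned Rayleigh difference with the target written on the left: `val(Y₀∗X₁)val(Y₁∗X₀) − val(Y₁∗X₁)val(Y₀∗X₀) = q²·⟪X₀∧X₁, Y₀∧Y₁⟫`.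
[folklore] -/
theorem rayleigh_eq_pairH' (q : ℝ) (X₀ X₁ Y₀ Y₁ : V5) :
    val q (conv Y₀ X₁) * val q (conv Y₁ X₀) - val q (conv Y₁ X₁) * val q (conv Y₀ X₀) =
      q ^ 2 * pairH q (wedgeH X₀ X₁) (wedgeH Y₀ Y₁) := by
  simp only [val_conv_hat, pairH, wedgeH]; ring

/-- **Rayleigh difference through an `a`-fan with an arbitrary fan vector**: `= q²·Φ_q(F; u, s)` (`rayleigh_crossFar_oneSided` of `…OneSided`,
freed from the word that generated `F`). [folklore] -/
theorem rayleigh_imgA (q : ℝ) (F u s : V5) :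
    val q (conv (conv s (edgeBC 0)) (fanCombo q F (conv (edgeAC 1) u))) * val q (conv (conv s (edgeBC 1)) (fanCombo q F (conv (edgeAC 0) u))) -
        val q (conv (conv s (edgeBC 1)) (fanCombo q F (conv (edgeAC 1) u))) * val q (conv (conv s (edgeBC 0)) (fanCombo q F (conv (edgeAC 0) u))) =
      q ^ 2 * fanPhi q F u s := by
  simp only [conv_edgeAC_zero, conv_edgeBC_zero_right']
  simp only [val_conv_fanCombo]
  simp only [val_conv_hat, hatAC_z0, hatAC_hx, hatAC_hy, hatAC_hz, hatAC_total, hatDetach_z0, hatDetach_hx, hatDetach_hy, hatDetach_hz,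
    hatDetach_total, hatBCr_z0, hatBCr_hx, hatBCr_hy, hatBCr_hz, hatBCr_total]
  simp only [fanPhi]
  ring

/-- `val(S ∗ fanComboB G X)` is linear in the `b`-fan coefficients. [folklore] -/
theorem val_conv_fanComboB_lin (q : ℝ) (S G X : V5) :
    val q (conv S (fanComboB q G X)) =
      G.zac * val q (conv S X) + G.z1 * val q (conv S (conv (edgeBC 1) X)) + G.z0 * val q (conv S (detach q X)) +
        G.zab * val q (conv S (detach q (conv (edgeBC 1) X))) + G.zbc * val q (conv S (conv (edgeBC 1) (detach q X))) := by
  simp only [fanComboB, val, conv, V5.total]; ring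

/-- Hat coordinates of `BC_1 ∗ X`: `Ẑ₀ = 0`. [folklore] -/
theorem hatBCl_z0 (X : V5) : (conv (edgeBC 1) X).z0 = 0 := by
  simp only [conv, edgeBC]; ring

/-- Hat coordinates of `BC_1 ∗ X`: `x̂ = 0`. [folklore] -/
theorem hatBCl_hx (X : V5) : hx (conv (edgeBC 1) X) = 0 := by
  simp only [conv, edgeBC, hx]; ring

/-- Hat coordinates of `BC_1 ∗ X`: `ŷ = 0`. [folklore] -/
theorem hatBCl_hy (X : V5) : hy (conv (edgeBC 1) X) = 0 := by
  simp only [conv, edgeBC, hy]; ring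

/-- Hat coordinates of `BC_1 ∗ X`: `ẑ = ẑ(X)`. [folklore] -/
theorem hatBCl_hz (X : V5) : hz (conv (edgeBC 1) X) = hz X := by
  simp only [conv, edgeBC, hz]; ring

/-- Hat coordinates of `BC_1 ∗ X`: `v̂ = v̂(X)`. [folklore] -/
theorem hatBCl_total (X : V5) : (conv (edgeBC 1) X).total = X.total := by
  simp only [conv, edgeBC, V5.total]; ring

/-- Hat coordinates under `swapAB`: `Ẑ₀`. [folklore] -/
theorem swapAB_z0' (s : V5) : (swapAB s).z0 = s.z0 := rfl

/-- Hat coordinates under `swapAB`: `x̂` is unchanged. [folklore] -/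
theorem hx_swapAB (s : V5) : hx (swapAB s) = hx s := rfl

/-- Hat coordinates under `swapAB`: `ŷ ↦ ẑ`. [folklore] -/
theorem hy_swapAB (s : V5) : hy (swapAB s) = hz s := rfl

/-- Hat coordinates under `swapAB`: `ẑ ↦ ŷ`. [folklore] -/
theorem hz_swapAB (s : V5) : hz (swapAB s) = hy s := rfl

/-- Hat coordinates under `swapAB`: `v̂` is unchanged. [folklore] -/
theorem total_swapAB (s : V5) : (swapAB s).total = s.total := by
  simp only [swapAB, V5.total]; ring

/-- `Φ_q` at the mirrored arguments, as a polynomial in the hat coordinates of `u, s` and the masses of `G`. [folklore] -/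
theorem fanPhi_mirror_eq (q : ℝ) (G u s : V5) :
    fanPhi q (swapAC G) (swapAB s) (swapAB u) =
      (1 - q) * (hx s * s.total * hx u * u.total + (1 - q) * hz s * hy s * hz u * hy u - (2 - q) * s.z0 * s.total * u.z0 * u.total) *
          (G.zac ^ 2 + G.zac * G.z1 + G.zac * G.zab) +
        (1 - q) * (hy s * s.total - (2 - q) * s.z0 * s.total + (1 - q) * hx s * hz s) *
          ((hz u * u.total - (2 - q) * u.z0 * u.total + (1 - q) * hx u * hy u) * (G.z0 ^ 2 + G.z0 * G.zbc) +
            hz u * u.total * (G.zab ^ 2 + G.z1 * G.zab + G.zac * G.zab) + 2 * u.total * (hz u - (2 - q) / 2 * u.z0) * G.z0 * G.zab) +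
        G.zac * G.z0 * (-(1 - q) * (2 - q) * (hy s * s.total - (1 - q) * s.z0 * s.total) * u.z0 * u.total +
            (1 - q) * (hy s * s.total - (2 - q) * s.z0 * s.total + (1 - q) * hx s * hz s) * hz u * u.total +
            (1 - q) ^ 2 * (2 - q) * (s.z0 * hz s - hz s * hy s) * u.z0 * hy u + (1 - q) ^ 2 * (2 * hz s * hy s - (2 - q) * s.z0 * hz s) * hz u * hy u +
            (1 - q) * q * hx s * s.total * hx u * u.total + (1 - q) ^ 2 * (hy s * s.total - hx s * hz s) * hx u * hy u) +
        G.zac * G.zbc * ((1 - q) * hx s * s.total * hx u * u.total - (1 - q) * (2 - q) * s.z0 * s.total * u.z0 * u.total +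
            (1 - q) ^ 2 * (2 - q) * (s.z0 * hz s - hz s * hy s) * u.z0 * hy u + (1 - q) ^ 2 * (hy s * s.total - hx s * hz s) * hx u * hy u +
            (1 - q) ^ 2 * hz s * hy s * hz u * hy u) +
        G.z1 * G.z0 * ((1 - q) * (hy s * s.total - (2 - q) * s.z0 * s.total + (1 - q) * hx s * hz s) * hz u * u.total -
            (1 - q) * (2 - q) * (hy s * s.total - (2 - q) * s.z0 * s.total) * u.z0 * u.total +
            (1 - q) ^ 2 * (hz s * hy s - (2 - q) * s.z0 * hz s) * hz u * hy u - (1 - q) ^ 2 * hx s * s.total * hx u * u.total) +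
        G.zbc * G.zab * ((1 - q) * (hy s * s.total - (2 - q) * s.z0 * s.total + (1 - q) * hx s * hz s) * hz u * u.total +
            (1 - q) ^ 2 * ((2 - q) * s.z0 * hz s - hz s * hy s) * hz u * hy u + (1 - q) ^ 2 * hx s * s.total * hx u * u.total -
            (1 - q) ^ 2 * (2 - q) * hx s * hz s * u.z0 * u.total) := by
  simp only [fanPhi, hx_swapAB, hy_swapAB, hz_swapAB, total_swapAB, swapAB_z0']
  simp only [swapAC]

/-- **Rayleigh difference through a `b`-fan (the mirror of LEMMA′'s identity)**: with the `a`-pinned input `u` and the `b`-pinned target `s`,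
`Z¹⁰Z⁰¹ − Z¹¹Z⁰⁰ = q²·Φ_q(swapAC G; swapAB s, swapAB u)` — the reversed `a`-fan between the mirrored target and the mirrored input. [folklore] -/
theorem rayleigh_imgB (q : ℝ) (G u s : V5) :
    val q (conv (conv s (edgeBC 0)) (fanComboB q G (conv (edgeAC 1) u))) * val q (conv (conv s (edgeBC 1)) (fanComboB q G (conv (edgeAC 0) u))) -
        val q (conv (conv s (edgeBC 1)) (fanComboB q G (conv (edgeAC 1) u))) * val q (conv (conv s (edgeBC 0)) (fanComboB q G (conv (edgeAC 0) u))) =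
      q ^ 2 * fanPhi q (swapAC G) (swapAB s) (swapAB u) := by
  rw [fanPhi_mirror_eq]
  simp only [conv_edgeAC_zero, conv_edgeBC_zero_right']
  simp only [val_conv_fanComboB_lin]
  simp only [val_conv_hat, hatAC_z0, hatAC_hx, hatAC_hy, hatAC_hz, hatAC_total, hatDetach_z0, hatDetach_hx, hatDetach_hy,
    hatDetach_hz, hatDetach_total, hatBCl_z0, hatBCl_hx, hatBCl_hy, hatBCl_hz, hatBCl_total, hatBCr_z0, hatBCr_hx, hatBCr_hy, hatBCr_hz,
    hatBCr_total]
  ring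

/-- The `a`-image against a target: `q²·⟪imgA F u, (s∗BC_0)∧(s∗BC_1)⟫ = q²·Φ_q(F; u, s)`. [folklore] -/
theorem pairH_imgA_target (q : ℝ) (F u s : V5) :
    q ^ 2 * pairH q (imgA q F u) (wedgeH (conv s (edgeBC 0)) (conv s (edgeBC 1))) = q ^ 2 * fanPhi q F u s := by
  rw [imgA, ← rayleigh_eq_pairH', rayleigh_imgA]

/-- The `b`-image against a target: `q²·⟪imgB G u, (s∗BC_0)∧(s∗BC_1)⟫ = q²·Φ_q(swapAC G; swapAB s, swapAB u)`. [folklore] -/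
theorem pairH_imgB_target (q : ℝ) (G u s : V5) :
    q ^ 2 * pairH q (imgB q G u) (wedgeH (conv s (edgeBC 0)) (conv s (edgeBC 1))) = q ^ 2 * fanPhi q (swapAC G) (swapAB s) (swapAB u) := by
  rw [imgB, ← rayleigh_eq_pairH', rayleigh_imgB]

/-- Masses `≥ 0` are preserved by `swapAC`. [folklore] -/
theorem nonneg_swapAC {Z : V5} (h : Z.Nonneg) : (swapAC Z).Nonneg := by
  obtain ⟨h0, h1, h2, h3, h4⟩ := h; exact ⟨h0, h3, h2, h1, h4⟩

/-- Masses `≥ 0` are preserved by `swapAB`. [folklore] -/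
theorem nonneg_swapAB {Z : V5} (h : Z.Nonneg) : (swapAB Z).Nonneg := by
  obtain ⟨h0, h1, h2, h3, h4⟩ := h; exact ⟨h0, h1, h3, h2, h4⟩

/-- **LEMMA′ for `b`-fans**: `Φ_q(swapAC G; swapAB s, swapAB u) ≥ 0` for `G, u, s ∈ InKE q`, `0 < q ≤ 1` — from `fanPhi_nonneg_validU` with
`(U_c)(swapAC G) = (U_a)(G)`, `(U_b)(swapAB s) = (U_a)(s)`, `(U_a)(swapAB u) = (U_b)(u)`. [folklore] -/
theorem fanPhi_mirror_nonneg {q : ℝ} (hq0 : 0 < q) (hq1 : q ≤ 1) {G u s : V5} (hG : InKE q G) (hu : InKE q u) (hs : InKE q s) :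
    0 ≤ fanPhi q (swapAC G) (swapAB s) (swapAB u) := by
  rcases eq_or_lt_of_le hq1 with h1 | h1
  · subst h1
    have : fanPhi 1 (swapAC G) (swapAB s) (swapAB u) = 0 := by simp only [fanPhi]; ring
    rw [this]
  · refine fanPhi_nonneg_validU hq0 h1 (nonneg_swapAC (hG.valid hq0.le hq1).nonneg) ?_ (nonneg_swapAB (hs.valid hq0.le hq1).nonneg) ?_
      (nonneg_swapAB (hu.valid hq0.le hq1).nonneg) ?_
    · rw [swapAC_swapAC]; exact hG.uCond hq0 hq1
    · rw [swapAB_swapAB]; exact hs.uCond hq0 hq1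
    · exact hu.uCondB hq0 hq1

/-- **Every target lies in the dual** (`0 < q ≤ 1`, `s ∈ InKE q`): LEMMA′ (`fanPhi_nonneg`) and its mirror. [folklore] -/
theorem target_osDual {q : ℝ} (hq0 : 0 < q) (hq1 : q ≤ 1) {s : V5} (hs : InKE q s) :
    OSDual q (wedgeH (conv s (edgeBC 0)) (conv s (edgeBC 1))) := by
  have hq2 : (q ^ 2 : ℝ) ≠ 0 := pow_ne_zero 2 hq0.ne'
  refine ⟨fun F w hF hw => ?_, fun G w hG hw => ?_⟩
  · rw [mul_left_cancel₀ hq2 (pairH_imgA_target q F w s)]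
    exact fanPhi_nonneg hq0 hq1 F w s hF hw hs
  · rw [mul_left_cancel₀ hq2 (pairH_imgB_target q G w s)]
    exact fanPhi_mirror_nonneg hq0 hq1 hG hw hs

/-- The one-sided cone pairs non-negatively with every target. [folklore] -/
theorem pairH_osCone_target {q : ℝ} (hq0 : 0 < q) (hq1 : q ≤ 1) {s : V5} (hs : InKE q s) :
    ∀ β, β ∈ osCone q → 0 ≤ pairH q β (wedgeH (conv s (edgeBC 0)) (conv s (edgeBC 1))) :=
  fun _ hβ => hβ _ (target_osDual hq0 hq1 hs)

/-! ### The reduction: (CL-a) ∧ (CL-b) ⟹ the far cross-apex pair for every middle -/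

/-- **ONE-SIDED DOMINANCE ⟹ THE ALGEBRA-LEVEL FAR THEOREM.**  Under (CL-a) and (CL-b), for `0 < q ≤ 1`, the Rayleigh difference of the `crossFarZ`
valuations is `≥ 0` for EVERY block list with weights in `[0,1]`, every last rim weight and all rests `u, s ∈ InKE q` — the hypothesis `halg` of
`negCorr_spokes_cross_far_of_inKE` in full generality. [folklore] -/
theorem rayleigh_crossFar_of_dominance {q : ℝ} (hq0 : 0 < q) (hq1 : q ≤ 1) (hA : HypA q) (hB : HypB q) :
    ∀ (mids : List (ℝ × ℝ × ℝ)), UnitBlocks mids → ∀ rd : ℝ, 0 ≤ rd → rd ≤ 1 → ∀ u s : V5, InKE q u → InKE q s →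
      0 ≤ crossFarZ q mids rd u s 1 0 * crossFarZ q mids rd u s 0 1 - crossFarZ q mids rd u s 1 1 * crossFarZ q mids rd u s 0 0 := by
  intro mids hm rd hrd0 hrd1 u s hu hs
  have key := rayleigh_crossFar_of_isLetterCone (isLetterCone_osCone hA hB) hm hrd0 hrd1 (input_mem_osCone hu)
    (pairH_osCone_target hq0 hq1 hs)
  simp only [crossFarZ]
  linarith [key]

open MeasureTheory Literature.Probability.LatticeModels Literature.Probability.Percolation
open scoped Classical

variable {V : Type*} [Fintype V]

section Setting

variable {a b : V} {c : ℕ → V} {m : ℕ}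
variable (hab : a ≠ b) (hinj : ∀ j k, j ≤ m → k ≤ m → c j = c k → j = k) (hca : ∀ j, j ≤ m → c j ≠ a) (hcb : ∀ j, j ≤ m → c j ≠ b)
include hab hinj hca hcb

/-- **ONE-SIDED DOMINANCE ⟹ NEGATIVE CORRELATION OF EVERY CROSS-APEX PAIR AT EVERY DISTANCE.**  If the two closure statements (CL-a), (CL-b)
hold at `q ∈ (0,1]`, then for every weighted double fan (`card V = m + 3`, weights supported on the double-fan pairs) and all `j < k ≤ m`:
`φ(J_{a c_j} ∩ J_{b c_k}) ≤ φ(J_{a c_j})·φ(J_{b c_k})` — no restriction on the middle. [folklore] -/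
theorem negCorr_spokes_cross_far_of_dominance (hcard : Fintype.card V = m + 3) {q : ℝ} (hq0 : 0 < q) (hq1 : q ≤ 1)
    (w : Sym2 V → unitInterval) (hsupp : ∀ e, e ∉ dfPairs a b c m → w e = 0) (hA : HypA q) (hB : HypB q)
    {j k : ℕ} (hjk : j < k) (hk : k ≤ m) :
    (rcMeasureW w q ∅).real ({ω : BondConfig V | s(a, c j) ∈ ω} ∩ {ω | s(b, c k) ∈ ω}) ≤
      (rcMeasureW w q ∅).real {ω : BondConfig V | s(a, c j) ∈ ω} * (rcMeasureW w q ∅).real {ω : BondConfig V | s(b, c k) ∈ ω} :=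
  negCorr_spokes_cross_far_of_inKE hab hinj hca hcb hcard hq0 w hsupp (rayleigh_crossFar_of_dominance hq0 hq1 hA hB) hjk hk

end Setting

end ThreeApex

end FK

end Summit.CriticalPhenomena.PercolationContinuityZ3.Theorems
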